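/-
Copyright (c) 2026. All rights reserved.
Released under Apache 2.0 license as described in the file LICENSE.
Authors: abc-iut cell, campaign-S prover seat abc-iut-S6 (wave 2).
-/
import Literature.IUT.LogVolume.TensorPacketUnramified
import Literature.IUT.LogVolume.PacketDifferent
import HarnessLib

/-!
# [IUTchIV] Proposition 1.2 (ii)–(iv) — unconditional

Mochizuki, *Inter-universal Teichmüller theory IV*, RIMS manuscript (Apr. 2020), §1, Prop. 1.2 (ii)–(iv),
kurims pp. 10–11.  The typed statements `Prop12ii`, `Prop12ii'`, `Prop12iii`, `Prop12iii'`, `Prop12iv` of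
abc-iut-S1's `TensorPacketRing.lean`, DISCHARGED: the implications from `Prop11 p k`
(`TensorPacketLogProofs.lean`, `TensorPacketUnramified.lean`, abc-iut-S6) composed with abc-iut-S5's
`prop11_holds : Prop11 p k` (`PacketDifferent.lean`, [IUTchIV] Prop. 1.1).  Theorems only.
-/

noncomputable section

namespace Literature.IUT.LogVolume

variable (p : ℕ) [Fact p.Prime]
variable {I : Type} [Fintype I] [DecidableEq I]
variable (k : I → Type) [∀ i, NontriviallyNormedField (k i)] [∀ i, NormedAlgebra ℚ_[p] (k i)]
  [∀ i, IsUltrametricDist (k i)] [∀ i, ProperSpace (k i)]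

/-- **[IUTchIV] Prop. 1.2 (ii)** (p. 10), proved. [claim: Mochizuki2012, status: disputed] -/
theorem prop12ii_holds : Prop12ii p k := prop12ii_of_prop11 p k (prop11_holds p k)

/-- **[IUTchIV] Prop. 1.2 (ii), "In particular"** (p. 10), proved. [claim: Mochizuki2012, status: disputed] -/
theorem prop12ii'_holds : Prop12ii' p k := prop12ii'_of_prop11 p k (prop11_holds p k)

/-- **[IUTchIV] Prop. 1.2 (iii)** (p. 11), proved. [claim: Mochizuki2012, status: disputed] -/
theorem prop12iii_holds : Prop12iii p k := prop12iii_of_prop11 p k (prop11_holds p k)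

/-- **[IUTchIV] Prop. 1.2 (iii), "In particular"** (p. 11), proved. [claim: Mochizuki2012, status: disputed] -/
theorem prop12iii'_holds : Prop12iii' p k := prop12iii'_of_prop11 p k (prop11_holds p k)

/-- **[IUTchIV] Prop. 1.2 (iv)** (p. 11), proved. [claim: Mochizuki2012, status: disputed] -/
theorem prop12iv_holds : Prop12iv p k := prop12iv_of_prop11 p k (prop11_holds p k)


/-! ## Exact-name discharges for every index type `I` (appended 2026-08-28)

The named facts `Prop12ii'`, `Prop12iii'`, `Prop12iv` carry no `[DecidableEq I]` (their bodies do not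
use it), while the provers above live under this file's `variable [DecidableEq I]`; the instance is
supplied classically. D-0026 bookkeeping: no statement, definition or attribute is edited; no new
named fact. -/

omit [DecidableEq I] in
/-- **[IUTchIV] Prop. 1.2 (ii), "In particular"** — `Prop12ii'` holds for every `I` (exact-name discharge;
`DecidableEq I` chosen classically). [claim: Mochizuki2012, status: disputed] -/
theorem Prop12ii'_holds : Prop12ii' p k := by
  classical
  exact prop12ii'_holds p k

omit [DecidableEq I] in
/-- **[IUTchIV] Prop. 1.2 (iii), "In particular"** — `Prop12iii'` holds for every `I` (exact-name discharge;
`DecidableEq I` chosen classically). [claim: Mochizuki2012, status: disputed] -/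
theorem Prop12iii'_holds : Prop12iii' p k := by
  classical
  exact prop12iii'_holds p k

omit [DecidableEq I] in
/-- **[IUTchIV] Prop. 1.2 (iv)** — `Prop12iv` holds for every `I` (exact-name discharge; `DecidableEq I`
chosen classically). [claim: Mochizuki2012, status: disputed] -/
theorem Prop12iv_holds : Prop12iv p k := by
  classical
  exact prop12iv_holds p k

end Literature.IUT.LogVolume

end
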